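import Mathlib
import HarnessLib
import Literature.Analysis.Calculus.SardProofs
import Literature.Analysis.FluidPDE.TaoAveragedNondegeneracy
import Summits.NavierStokesRegularity.NavierStokesRegularity.Theorems.UnthreadedDoorNetFluxDefs
import Summits.NavierStokesRegularity.NavierStokesRegularity.Theorems.UnthreadedDoorNetFluxNearCentreComparison

/-!
# Route `UnthreadedDoor`, crux `PoloidalLiouville` (stmt-NavierStokesRegularity-1222), WALL W1 — netflux line,
# NF-1a toolkit: SARD'S THEOREM FOR FUNCTIONS ON A ROUND SPHERE OF `ℝ³`

Tool for the research stub NF-1a `stub_extremalHeadEMF` (`NetFlux.ExtremalHeadEMF`) of the registered line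
`Cruxes/PoloidalLiouville/Lines/netflux_typei_gap.lean` (planner ns-idea-14; toolkit `netflux_typei_gap_nf1a_toolkit.lean`,
sub-stub «Sard-constancy»).  Setting of the level-Lipschitz lemma (Λ): on the sphere `S = S_r(x₀)`, `r > 0`, a function
`h ∈ C¹(ℝ³ ∖ {x₀})` whose TANGENTIAL gradient is `ν ∇f` for `f, ν` smooth off `x₀`
(`∇h − ν∇f ∥ x − x₀`, i.e. `cross (∇h − ν∇f) (x − x₀) = 0`).  Then:

* `exists_sphericalParam`: the smooth surjective parametrisation `P(θ,φ) = x₀ + r(sin θ cos φ, sin θ sin φ, cos θ)` of `S`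
  by `ℝ² = EuclideanSpace ℝ (Fin 2)` (no injectivity or immersivity is needed), its tangency `⟪P − x₀, DP·w⟫ = 0`;
* `contDiff_comp_sphericalParam`: `h ∘ P ∈ C^∞(ℝ²)` — its derivative is `w ↦ ⟪(ν∇f)(P u), DP(u) w⟫` (the unknown radial
  part of `∇h` is killed by tangency), a smooth field;
* **`volume_image_sphCrit_eq_zero`**: the set of TANGENTIAL-CRITICAL VALUES `h '' {x ∈ S : ∇h(x) × (x − x₀) = 0}` is
  Lebesgue-null — Sard's theorem (the tree's `Literature.Analysis.Calculus.sard_holds`, `m = 2`, `n = 1`) for `h ∘ P`,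
  since every tangential-critical point of `h` is `P` of a critical point of `h ∘ P`;
* `volume_image_sphCrit_of_parallel_eq_zero`: in particular `h '' {x ∈ S : ∇f(x) × (x − x₀) = 0}` is null (critical
  points of `f|_S` are tangential-critical for `h`).

WHAT THIS IS NOT: no NS statement; `PoloidalLiouville` (1222), W1, the line's rung and NF-1a itself stay OPEN here.
`--supports stmt-NavierStokesRegularity-1222 --as helper`.  [folklore]
-/

noncomputable section

-- the summit and its single sub-problem share the name (CONVENTIONS §1)
set_option linter.dupNamespace false

open Set Function Filter Topology InnerProductSpace MeasureTheory
open scoped RealInnerProductSpace ContDiff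

namespace Summit.NavierStokesRegularity.NavierStokesRegularity.Theorems.PoloidalLiouville.NetFlux

open Literature.Analysis Literature.Analysis.FluidPDE

/-! ### Vector algebra: a vector parallel to `y` is orthogonal to everything orthogonal to `y` -/

/-- If `p × y = 0` and `⟪y, τ⟫ = 0` with `y ≠ 0` then `⟪p, τ⟫ = 0` (`p` is a multiple of `y`). [folklore] -/
theorem inner_eq_zero_of_cross_eq_zero_of_inner_eq_zero {p y τ : E3} (hpy : cross p y = 0) (hyτ : ⟪y, τ⟫ = 0)
    (hy : y ≠ 0) : ⟪p, τ⟫ = 0 := by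
  have h0 : cross p y 0 = 0 := by rw [hpy]; rfl
  have h1 : cross p y 1 = 0 := by rw [hpy]; rfl
  have h2 : cross p y 2 = 0 := by rw [hpy]; rfl
  rw [Tao2016.cross_apply_zero] at h0
  rw [Tao2016.cross_apply_one] at h1
  rw [Tao2016.cross_apply_two] at h2
  rw [Tao2016.real_inner_fin3] at hyτ ⊢
  have hy2 : y 0 * y 0 + y 1 * y 1 + y 2 * y 2 ≠ 0 := by
    rw [← Tao2016.real_inner_fin3, real_inner_self_eq_norm_sq]
    exact pow_ne_zero 2 (norm_ne_zero_iff.2 hy)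
  have key : (p 0 * τ 0 + p 1 * τ 1 + p 2 * τ 2) * (y 0 * y 0 + y 1 * y 1 + y 2 * y 2) = 0 := by
    linear_combination (τ 1 * y 2 - τ 2 * y 1) * h0 + (τ 2 * y 0 - τ 0 * y 2) * h1
      + (τ 0 * y 1 - τ 1 * y 0) * h2 + (p 0 * y 0 + p 1 * y 1 + p 2 * y 2) * hyτ
  exact (mul_eq_zero.1 key).resolve_right hy2

/-! ### The spherical-coordinate parametrisation -/

/-- Coordinates on `ℝ²` are smooth. [folklore] -/
private theorem contDiff_coord2 (i : Fin 2) : ContDiff ℝ ∞ fun u : EuclideanSpace ℝ (Fin 2) => u i :=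
  contDiff_euclidean.1 (contDiff_id (𝕜 := ℝ) (E := EuclideanSpace ℝ (Fin 2))) i

/-- The spherical-coordinate parametrisation `P u = x₀ + r · (sin θ cos φ, sin θ sin φ, cos θ)`, `u = (θ, φ)`, of the sphere
`S_r(x₀)`: smooth on `ℝ²`, valued in the sphere, onto the sphere (for `r > 0`), with tangent derivative
(`⟪P u − x₀, DP(u) w⟫ = 0`, by differentiating the constant `‖P u − x₀‖²`).  No injectivity or immersivity is claimed
or needed. [folklore] -/
theorem exists_sphericalParam (x₀ : E3) {r : ℝ} (hr : 0 < r) :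
    ∃ P : EuclideanSpace ℝ (Fin 2) → E3, ContDiff ℝ ∞ P ∧ (∀ u, ‖P u - x₀‖ = r) ∧
      (∀ x ∈ Metric.sphere x₀ r, ∃ u, P u = x) ∧ (∀ u w, ⟪P u - x₀, fderiv ℝ P u w⟫ = 0) := by
  -- the direction field `σ(θ, φ) = (sin θ cos φ, sin θ sin φ, cos θ)`
  set σ : EuclideanSpace ℝ (Fin 2) → E3 := fun u =>
    (Real.sin (u 0) * Real.cos (u 1)) • EuclideanSpace.single (0 : Fin 3) (1 : ℝ)
      + (Real.sin (u 0) * Real.sin (u 1)) • EuclideanSpace.single (1 : Fin 3) (1 : ℝ)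
      + Real.cos (u 0) • EuclideanSpace.single (2 : Fin 3) (1 : ℝ) with hσ
  have hσ0 : ∀ u, σ u 0 = Real.sin (u 0) * Real.cos (u 1) := fun u => by simp [hσ]
  have hσ1 : ∀ u, σ u 1 = Real.sin (u 0) * Real.sin (u 1) := fun u => by simp [hσ]
  have hσ2 : ∀ u, σ u 2 = Real.cos (u 0) := fun u => by simp [hσ]
  have hσn : ∀ u, ‖σ u‖ = 1 := by
    intro u
    have h : ‖σ u‖ ^ 2 = 1 := by
      rw [← real_inner_self_eq_norm_sq, Tao2016.real_inner_fin3, hσ0, hσ1, hσ2]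
      nlinarith [Real.sin_sq_add_cos_sq (u 0), Real.sin_sq_add_cos_sq (u 1)]
    nlinarith [norm_nonneg (σ u)]
  have hσs : ContDiff ℝ ∞ σ := by
    have ha : ContDiff ℝ ∞ fun u : EuclideanSpace ℝ (Fin 2) => Real.sin (u 0) * Real.cos (u 1) :=
      (Real.contDiff_sin.comp (contDiff_coord2 0)).mul (Real.contDiff_cos.comp (contDiff_coord2 1))
    have hb : ContDiff ℝ ∞ fun u : EuclideanSpace ℝ (Fin 2) => Real.sin (u 0) * Real.sin (u 1) :=
      (Real.contDiff_sin.comp (contDiff_coord2 0)).mul (Real.contDiff_sin.comp (contDiff_coord2 1))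
    have hc : ContDiff ℝ ∞ fun u : EuclideanSpace ℝ (Fin 2) => Real.cos (u 0) :=
      Real.contDiff_cos.comp (contDiff_coord2 0)
    exact ((ha.smul (contDiff_const (c := EuclideanSpace.single (0 : Fin 3) (1 : ℝ)))).add
      (hb.smul (contDiff_const (c := EuclideanSpace.single (1 : Fin 3) (1 : ℝ))))).add
      (hc.smul (contDiff_const (c := EuclideanSpace.single (2 : Fin 3) (1 : ℝ))))
  -- every unit vector is a direction `σ u`
  have honto : ∀ ξ : E3, ‖ξ‖ = 1 → ∃ u, σ u = ξ := by
    intro ξ hξ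
    have hsq : ξ 0 * ξ 0 + ξ 1 * ξ 1 + ξ 2 * ξ 2 = 1 := by
      rw [← Tao2016.real_inner_fin3, real_inner_self_eq_norm_sq, hξ, one_pow]
    set w : ℂ := (ξ 0 : ℂ) + (ξ 1 : ℂ) * Complex.I with hw
    have hwre : w.re = ξ 0 := by simp [hw]
    have hwim : w.im = ξ 1 := by simp [hw]
    have hwn : ‖w‖ ^ 2 = ξ 0 * ξ 0 + ξ 1 * ξ 1 := by
      rw [Complex.sq_norm, Complex.normSq_apply, hwre, hwim]
    have hξ2 : -1 ≤ ξ 2 ∧ ξ 2 ≤ 1 := by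
      constructor <;> nlinarith [sq_nonneg (ξ 0), sq_nonneg (ξ 1), sq_nonneg (ξ 2 - 1), sq_nonneg (ξ 2 + 1)]
    set θ := Real.arccos (ξ 2) with hθ
    have hcos : Real.cos θ = ξ 2 := Real.cos_arccos hξ2.1 hξ2.2
    have hsin : Real.sin θ = ‖w‖ := by
      rw [hθ, Real.sin_arccos]
      have : 1 - ξ 2 ^ 2 = ‖w‖ ^ 2 := by rw [hwn]; nlinarith [hsq]
      rw [this, Real.sqrt_sq (norm_nonneg _)]
    have hpol := Complex.norm_mul_exp_arg_mul_I w
    have hre : ξ 0 = ‖w‖ * Real.cos (Complex.arg w) := by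
      have := congrArg Complex.re hpol
      rw [hwre] at this
      rw [← this, Complex.re_ofReal_mul, Complex.exp_ofReal_mul_I_re]
    have him : ξ 1 = ‖w‖ * Real.sin (Complex.arg w) := by
      have := congrArg Complex.im hpol
      rw [hwim] at this
      rw [← this, Complex.im_ofReal_mul, Complex.exp_ofReal_mul_I_im]
    set u : EuclideanSpace ℝ (Fin 2) := WithLp.toLp 2 ![θ, Complex.arg w] with hu
    have h0 : u 0 = θ := rfl
    have h1 : u 1 = Complex.arg w := rfl
    have e0 := hσ0 u
    have e1 := hσ1 u
    have e2 := hσ2 u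
    rw [h0, h1, hsin] at e0 e1
    rw [h0, hcos] at e2
    refine ⟨u, ?_⟩
    ext i
    fin_cases i
    · exact e0.trans hre.symm
    · exact e1.trans him.symm
    · exact e2
  refine ⟨fun u => x₀ + r • σ u, contDiff_const.add (hσs.const_smul r), fun u => ?_, fun x hx => ?_, fun u w => ?_⟩
  · rw [add_sub_cancel_left, norm_smul, hσn, mul_one, Real.norm_eq_abs, abs_of_pos hr]
  · have hx' : ‖x - x₀‖ = r := mem_sphere_iff_norm.1 hx
    have hξ : ‖r⁻¹ • (x - x₀)‖ = 1 := by
      rw [norm_smul, hx', Real.norm_eq_abs, abs_of_pos (inv_pos.2 hr), inv_mul_cancel₀ hr.ne']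
    obtain ⟨u, hu⟩ := honto _ hξ
    refine ⟨u, ?_⟩
    simp only [hu, smul_smul, mul_inv_cancel₀ hr.ne', one_smul, add_sub_cancel]
  · -- differentiate the constant `‖P u - x₀‖²`
    have hPd : DifferentiableAt ℝ (fun u => x₀ + r • σ u) u :=
      ((contDiff_const.add (hσs.const_smul r)).differentiable (by simp)).differentiableAt
    have hd : HasFDerivAt (fun u => x₀ + r • σ u - x₀) (fderiv ℝ (fun u => x₀ + r • σ u) u) u := by
      simpa using hPd.hasFDerivAt.sub_const x₀
    have hn := hd.norm_sq
    have hconst : (fun u : EuclideanSpace ℝ (Fin 2) => ‖x₀ + r • σ u - x₀‖ ^ 2) = fun _ => r ^ 2 := by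
      funext u
      rw [add_sub_cancel_left, norm_smul, hσn, mul_one, Real.norm_eq_abs, abs_of_pos hr]
    rw [hconst] at hn
    have huniq := hn.unique (hasFDerivAt_const (r ^ 2) u)
    have h := congrArg (fun L : EuclideanSpace ℝ (Fin 2) →L[ℝ] ℝ => L w) huniq
    simp only [FunLike.coe_smul, Pi.smul_apply, ContinuousLinearMap.comp_apply,
      innerSL_apply_apply] at h
    have h' : ⟪x₀ + r • σ u - x₀, (fderiv ℝ (fun u => x₀ + r • σ u) u) w⟫ = 0 := by
      simpa using h
    exact h'

/-! ### Smoothness of `h ∘ P` and its derivative -/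

section Param

variable {f h ν : E3 → ℝ} {x₀ : E3} {r : ℝ} {P : EuclideanSpace ℝ (Fin 2) → E3}

/-- The derivative of `h ∘ P`: `D(h ∘ P)(u) w = ⟪(ν ∇f)(P u), DP(u) w⟫` when the tangential gradient of `h` on the sphere
is `ν ∇f` and `P` is a tangent parametrisation. [folklore] -/
theorem hasFDerivAt_comp_sphericalParam (hr : 0 < r) (hP : ContDiff ℝ ∞ P) (hPr : ∀ u, ‖P u - x₀‖ = r)
    (hPt : ∀ u w, ⟪P u - x₀, fderiv ℝ P u w⟫ = 0) (hh : ContDiffOn ℝ 1 h ({x₀}ᶜ : Set E3))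
    (hpar : ∀ x ∈ Metric.sphere x₀ r, cross (gradient h x - ν x • gradient f x) (x - x₀) = 0)
    (u : EuclideanSpace ℝ (Fin 2)) :
    HasFDerivAt (fun u => h (P u)) ((innerSL ℝ (ν (P u) • gradient f (P u))).comp (fderiv ℝ P u)) u := by
  have hne : P u ≠ x₀ := fun h0 => by
    have := hPr u; rw [h0, sub_self, norm_zero] at this; exact hr.ne' this.symm
  have hhd : DifferentiableAt ℝ h (P u) :=
    (hh.differentiableOn one_ne_zero _ hne).differentiableAt (isOpen_compl_singleton.mem_nhds hne)
  have hPd : DifferentiableAt ℝ P u := (hP.differentiable (by simp)).differentiableAt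
  have hcomp : HasFDerivAt (fun u => h (P u)) ((fderiv ℝ h (P u)).comp (fderiv ℝ P u)) u :=
    hhd.hasFDerivAt.comp u hPd.hasFDerivAt
  refine hcomp.congr_fderiv ?_
  ext w
  simp only [ContinuousLinearMap.comp_apply, innerSL_apply_apply]
  rw [← inner_gradient_left (𝕜 := ℝ)]  -- `fderiv h (P u) τ = ⟪∇h (P u), τ⟫`
  have hy : P u - x₀ ≠ 0 := sub_ne_zero.2 hne
  have horth := inner_eq_zero_of_cross_eq_zero_of_inner_eq_zero (hpar (P u) (mem_sphere_iff_norm.2 (hPr u)))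
    (hPt u w) hy
  rw [inner_sub_left] at horth
  linarith

/-- `h ∘ P` is `C^∞` on `ℝ²`: it is differentiable with the smooth derivative field of
`hasFDerivAt_comp_sphericalParam` (`f, ν` smooth off the centre). [folklore] -/
theorem contDiff_comp_sphericalParam (hr : 0 < r) (hP : ContDiff ℝ ∞ P) (hPr : ∀ u, ‖P u - x₀‖ = r)
    (hPt : ∀ u w, ⟪P u - x₀, fderiv ℝ P u w⟫ = 0)
    (hf : ContDiffOn ℝ (⊤ : ℕ∞) f ({x₀}ᶜ : Set E3)) (hν : ContDiffOn ℝ (⊤ : ℕ∞) ν ({x₀}ᶜ : Set E3))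
    (hh : ContDiffOn ℝ 1 h ({x₀}ᶜ : Set E3))
    (hpar : ∀ x ∈ Metric.sphere x₀ r, cross (gradient h x - ν x • gradient f x) (x - x₀) = 0) :
    ContDiff ℝ ∞ fun u => h (P u) := by
  have hne : ∀ u, P u ≠ x₀ := fun u h0 => by
    have := hPr u; rw [h0, sub_self, norm_zero] at this; exact hr.ne' this.symm
  have hD := hasFDerivAt_comp_sphericalParam (f := f) (ν := ν) hr hP hPr hPt hh hpar
  rw [contDiff_infty_iff_fderiv]
  refine ⟨fun u => (hD u).differentiableAt, ?_⟩
  have heq : (fderiv ℝ fun u => h (P u)) =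
      fun u => (innerSL ℝ (ν (P u) • gradient f (P u))).comp (fderiv ℝ P u) :=
    funext fun u => (hD u).fderiv
  rw [heq]
  -- smoothness of the pieces
  have hPs : ContDiff ℝ ∞ P := hP
  have hmaps : ∀ u, P u ∈ ({x₀}ᶜ : Set E3) := hne
  have hνP : ContDiff ℝ ∞ fun u => ν (P u) :=
    contDiffOn_univ.1 (hν.comp hPs.contDiffOn fun u _ => hmaps u)
  have hgrad : ContDiffOn ℝ ∞ (gradient f) ({x₀}ᶜ : Set E3) := by
    have e : gradient f = fun z => (InnerProductSpace.toDual ℝ E3).symm (fderiv ℝ f z) := rfl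
    rw [e]
    exact (InnerProductSpace.toDual ℝ E3).symm.contDiff.comp_contDiffOn
      (hf.fderiv_of_isOpen isOpen_compl_singleton le_rfl)
  have hgP : ContDiff ℝ ∞ fun u => gradient f (P u) :=
    contDiffOn_univ.1 (hgrad.comp hPs.contDiffOn fun u _ => hmaps u)
  have hΦ : ContDiff ℝ ∞ fun u => ν (P u) • gradient f (P u) := hνP.smul hgP
  have hinner : ContDiff ℝ ∞ fun u => innerSL ℝ (ν (P u) • gradient f (P u)) :=
    (innerSL ℝ (E := E3)).contDiff.comp hΦ
  exact hinner.clm_comp (hPs.fderiv_right le_rfl)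

/-- At a tangential-critical point `x = P u` of `h` (`∇h(x) × (x − x₀) = 0`), `D(h ∘ P)(u) = 0`. [folklore] -/
theorem fderiv_comp_sphericalParam_eq_zero (hr : 0 < r) (hP : ContDiff ℝ ∞ P) (hPr : ∀ u, ‖P u - x₀‖ = r)
    (hPt : ∀ u w, ⟪P u - x₀, fderiv ℝ P u w⟫ = 0) (hh : ContDiffOn ℝ 1 h ({x₀}ᶜ : Set E3))
    {u : EuclideanSpace ℝ (Fin 2)} (hcrit : cross (gradient h (P u)) (P u - x₀) = 0) :
    fderiv ℝ (fun u => h (P u)) u = 0 := by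
  have hne : P u ≠ x₀ := fun h0 => by
    have := hPr u; rw [h0, sub_self, norm_zero] at this; exact hr.ne' this.symm
  have hhd : DifferentiableAt ℝ h (P u) :=
    (hh.differentiableOn one_ne_zero _ hne).differentiableAt (isOpen_compl_singleton.mem_nhds hne)
  have hPd : DifferentiableAt ℝ P u := (hP.differentiable (by simp)).differentiableAt
  have hd : HasFDerivAt (fun u => h (P u)) ((fderiv ℝ h (P u)).comp (fderiv ℝ P u)) u :=
    hhd.hasFDerivAt.comp u hPd.hasFDerivAt
  rw [hd.fderiv]
  ext w
  simp only [ContinuousLinearMap.comp_apply, FunLike.coe_zero, Pi.zero_apply]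
  rw [← inner_gradient_left (𝕜 := ℝ)]
  exact inner_eq_zero_of_cross_eq_zero_of_inner_eq_zero hcrit (hPt u w) (sub_ne_zero.2 hne)

end Param

/-! ### Sard on the sphere -/

/-- Transport of null sets from `EuclideanSpace ℝ (Fin 1)` to `ℝ` along the coordinate map. [folklore] -/
theorem volume_image_coord_eq_zero {N : Set (EuclideanSpace ℝ (Fin 1))} (hN : volume N = 0) :
    volume ((fun z : EuclideanSpace ℝ (Fin 1) => z 0) '' N) = 0 := by
  set e : EuclideanSpace ℝ (Fin 1) ≃ᵐ ℝ :=
    (MeasurableEquiv.toLp 2 (Fin 1 → ℝ)).symm.trans (MeasurableEquiv.funUnique (Fin 1) ℝ) with he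
  have hem : MeasurePreserving e volume volume :=
    (EuclideanSpace.volume_preserving_symm_measurableEquiv_toLp (Fin 1)).trans
      (volume_preserving_funUnique (Fin 1) ℝ)
  have hfun : (fun z : EuclideanSpace ℝ (Fin 1) => z 0) = e := by
    funext z; rfl
  rw [hfun, MeasurableEquiv.image_eq_preimage_symm, hem.symm.measure_preimage_equiv]
  exact hN

/-- **Sard's theorem on a round sphere (tangential-critical values are null).**  Let `r > 0`, `f, ν` smooth on
`ℝ³ ∖ {x₀}`, `h ∈ C¹(ℝ³ ∖ {x₀})` with `∇h − ν∇f ∥ (x − x₀)` on `S_r(x₀)` (the tangential gradient of `h` is `ν∇f`).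
Then the image under `h` of the set of points of the sphere where `∇h × (x − x₀) = 0` has Lebesgue measure zero.
Proof: `h ∘ P` is smooth for the spherical-coordinate parametrisation `P` (`contDiff_comp_sphericalParam`), every such
point is `P u` with `D(h∘P)(u) = 0`, and Sard's theorem for maps `ℝ² → ℝ¹` (`Literature.Analysis.Calculus.sard_holds`)
applies. [folklore] -/
theorem volume_image_sphCrit_eq_zero (f h ν : E3 → ℝ) (x₀ : E3) {r : ℝ} (hr : 0 < r)
    (hf : ContDiffOn ℝ (⊤ : ℕ∞) f ({x₀}ᶜ : Set E3)) (hν : ContDiffOn ℝ (⊤ : ℕ∞) ν ({x₀}ᶜ : Set E3))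
    (hh : ContDiffOn ℝ 1 h ({x₀}ᶜ : Set E3))
    (hpar : ∀ x ∈ Metric.sphere x₀ r, cross (gradient h x - ν x • gradient f x) (x - x₀) = 0) :
    volume (h '' {x : E3 | x ∈ Metric.sphere x₀ r ∧ cross (gradient h x) (x - x₀) = 0}) = 0 := by
  obtain ⟨P, hP, hPr, hPonto, hPt⟩ := exists_sphericalParam x₀ hr
  have hsmooth := contDiff_comp_sphericalParam hr hP hPr hPt hf hν hh hpar
  -- the `𝔼¹`-valued version of `h ∘ P`
  set v₁ : EuclideanSpace ℝ (Fin 1) := EuclideanSpace.single (0 : Fin 1) (1 : ℝ) with hv₁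
  set H : EuclideanSpace ℝ (Fin 2) → EuclideanSpace ℝ (Fin 1) := fun u => (h (P u)) • v₁ with hH
  have hHs : ContDiffOn ℝ ∞ H univ := (hsmooth.smul contDiff_const).contDiffOn
  have hH0 : ∀ u, H u 0 = h (P u) := fun u => by simp [hH, hv₁]
  have hv₁ne : v₁ ≠ 0 := fun h0 => by
    have : v₁ 0 = (0 : EuclideanSpace ℝ (Fin 1)) 0 := by rw [h0]
    simp [hv₁] at this
  -- Sard for `H`
  have hsard := Calculus.sard_holds H univ isOpen_univ hHs
  -- critical points of `h` on the sphere give critical points of `H`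
  have hsub : h '' {x : E3 | x ∈ Metric.sphere x₀ r ∧ cross (gradient h x) (x - x₀) = 0} ⊆
      (fun z : EuclideanSpace ℝ (Fin 1) => z 0) '' (H '' {u ∈ univ | ¬ Surjective (fderiv ℝ H u)}) := by
    rintro _ ⟨x, ⟨hx, hcrit⟩, rfl⟩
    obtain ⟨u, rfl⟩ := hPonto x hx
    have hz := fderiv_comp_sphericalParam_eq_zero hr hP hPr hPt hh hcrit
    have hHd : fderiv ℝ H u = 0 := by
      have hd : HasFDerivAt H ((fderiv ℝ (fun u => h (P u)) u).smulRight v₁) u :=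
        ((hsmooth.differentiable (by simp)).differentiableAt.hasFDerivAt).smul_const v₁
      rw [hd.fderiv, hz]
      ext w i
      simp
    refine ⟨H u, ⟨u, ⟨mem_univ u, ?_⟩, rfl⟩, hH0 u⟩
    rw [hHd]
    intro hsurj
    obtain ⟨w, hw⟩ := hsurj v₁
    exact hv₁ne (by simpa using hw.symm)
  exact measure_mono_null hsub (volume_image_coord_eq_zero hsard)

/-- **Corollary: values of `h` at critical points of `f|_S` are null.**  Under the same hypotheses the image under `h`
of `{x ∈ S_r(x₀) : ∇f(x) × (x − x₀) = 0}` has measure zero (there `∇h × (x − x₀) = (∇h − ν∇f) × (x−x₀) + ν ∇f × (x−x₀)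
= 0`). [folklore] -/
theorem volume_image_sphCrit_of_parallel_eq_zero (f h ν : E3 → ℝ) (x₀ : E3) {r : ℝ} (hr : 0 < r)
    (hf : ContDiffOn ℝ (⊤ : ℕ∞) f ({x₀}ᶜ : Set E3)) (hν : ContDiffOn ℝ (⊤ : ℕ∞) ν ({x₀}ᶜ : Set E3))
    (hh : ContDiffOn ℝ 1 h ({x₀}ᶜ : Set E3))
    (hpar : ∀ x ∈ Metric.sphere x₀ r, cross (gradient h x - ν x • gradient f x) (x - x₀) = 0) :
    volume (h '' {x : E3 | x ∈ Metric.sphere x₀ r ∧ cross (gradient f x) (x - x₀) = 0}) = 0 := by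
  have hsub : {x : E3 | x ∈ Metric.sphere x₀ r ∧ cross (gradient f x) (x - x₀) = 0} ⊆
      {x : E3 | x ∈ Metric.sphere x₀ r ∧ cross (gradient h x) (x - x₀) = 0} := by
    intro x hx
    refine ⟨hx.1, ?_⟩
    have h1 := hpar x hx.1
    rwa [cross_sub_left', Tao2016.cross_smul_left, hx.2, smul_zero, sub_zero] at h1
  exact measure_mono_null (image_mono hsub) (volume_image_sphCrit_eq_zero f h ν x₀ hr hf hν hh hpar)

end Summit.NavierStokesRegularity.NavierStokesRegularity.Theorems.PoloidalLiouville.NetFlux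

end
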